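import Mathlib.RingTheory.Smooth.Basic
import Summits.Ventures.HSemireg.EmbeddedFirstOrderDeformationsCocycle

/-!
# Venture HSemireg — flat first-order thickenings of a FORMALLY SMOOTH affine SPLIT: the section `σ`, the
# trivialisation `R[ε] ≃ R'` over `π`, and the flat lifts as a trivialised torsor (Prop. K's input «X_ε|_U ≅ U[ε]»)

HONEST FRAMING.  Lean side of the computation cell `pub-hsemireg` (track «S4-PUSH» (ii), seat s4-prove-3 g4, second route
for (S5)); log `s4push/prove-3/ATTEMPT-8.md` §8.  Plain commutative algebra: a flat first-order thickening `π : R' ↠ R`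
with parameter `e` (file `EmbeddedFirstOrderDeformationsTorsor`), a base ring `k` over which `R` is FORMALLY SMOOTH
(Mathlib's `Algebra.FormallySmooth`, the infinitesimal lifting property).  No scheme, sheaf, Čech complex, abelian
variety or semiregularity map is constructed; nothing here says that HC / HC_CM / HC_AV holds; no object is certified;
no Literature fact is declared.

WHY.  PROPOSITION K (G2-REDUCIBLE-POINT-THEOREM §3; Hartshorne, *Deformation Theory*, proof of Thm. 6.2 / Cor. 4.8)
begins «cover `X` by affine opens `U_α` with `X_ε|_{U_α} ≅ U_α[ε]`»: a first-order deformation of a NONSINGULAR affine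
scheme is trivial.  The files of this series typed the local dictionary (Prop. 2.3), the pseudotorsor of lifts
(Thm. 6.2 (a)), the twist formula, base change / localisation and the gluing on a cover — all for a thickening that is
ASSUMED split where a splitting is needed (`isLift_map_section`, `splitTorsorEquiv`,
`exists_isLift_iff_exists_compatible_translate` take the sections `σ_α` as data).  This file DISCHARGES that datum from
smoothness: the kernel `(e)` of `π` has square zero, so the infinitesimal lifting property of a formally smooth `k`-algebra
`R` against `π` yields a `k`-algebra SECTION `σ : R → R'` (`Algebra.FormallySmooth.liftOfSurjective`), and then
`(a, b) ↦ σ a + e σ b` is a RING ISOMORPHISM `R[ε] ≃ R'` over `π` — the thickening IS the trivial one, non-canonically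
(two sections differ by a derivation: file `…Cocycle`, `twistEquiv`).  For the block models of (S5) the rings are
polynomial rings and their localisations, formally smooth over `K` by Mathlib's instances.

CONTENT (namespace `Summit.Ventures.HSemireg.EmbeddedDeformation`):
* `IsFirstOrderThickening.mem_ker_iff`, `ker_pow_two_eq_bot` (`(ker π)² = 0`), `isNilpotent_ker`.
* **`IsFirstOrderThickening.exists_algHom_section`** — `R` formally smooth over `k`, `π` a `k`-algebra map ⟹
  `∃ σ : R →ₐ[k] R', π ∘ σ = id`; `exists_section` (ring-hom form).
* **`IsFirstOrderThickening.trivialization σ hσ : R[ε] ≃+* R'`**, `(a, b) ↦ σ a + e σ b`, with `trivialization_inl`,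
  `trivialization_eps`, **`map_trivialization`** (`π ∘ triv = fst`): «`X_ε|_U ≅ U[ε]`» for `U = Spec R`.
* `fst_transition`, `transition_eps`, **`transitionDerivation σ σ'`**, **`twist_transitionDerivation`**
  (`τ_σ⁻¹ ∘ τ_{σ'} = twist θ(σ,σ')` — Prop. K's transition functions `ψ_αβ = id + ε θ_αβ`, via file `…Cocycle`'s
  Hartshorne Ex. 5.2), `eps_mul_section_transitionDerivation` (`e σ(θ a) = σ' a − σ a`),
  **`transitionDerivation_cocycle`** (`θ(σ,σ″) = θ(σ,σ′) + θ(σ′,σ″)` — the Čech cocycle identity of Prop. K's `(θ_αβ)`),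
  `transitionDerivation_self`, `transitionDerivation_swap`, **`diff_map_section`** (the difference class of the two trivial lifts
  `σ(I)R'`, `σ'(I)R'` is `θ̄(σ,σ')|_I` — «`ψ_αβ` carries `J_{φ_β}` to `J_{φ_β + θ̄_αβ|_I}`» inside `R'`).
* **`nonempty_trivialization`**, **`nonempty_liftEquiv`** — over a formally smooth affine every flat first-order
  thickening is (non-canonically) the dual-number one, and the flat lifts of every ideal `I` are in bijection with
  `Hom_R(I, R/I)` (Hartshorne Thm. 6.2 (a), affine nonsingular case: the pseudotorsor is a trivialised torsor).
* `exists_section_mvPolynomial`, `exists_section_localization_mvPolynomial` — the instances of record: `R = K[x_1, …, x_n]`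
  and its localisations (the chart rings `D(f)`).
References: R. Hartshorne, *Deformation Theory*, GTM 257 (2010): §4 Prop. 4.4 (infinitesimal lifting property) and
Cor. 4.8 («infinitesimal deformations of nonsingular affine schemes are trivial») [corpus: book:springernd-deformation-theory
p0033, p0035], §5 Ex. 5.2, §6 Thm. 6.2 (a); EGA IV 17.1.1 (formal smoothness = infinitesimal lifting); Mathlib
`Mathlib.RingTheory.Smooth.Basic`.
-/

open DualNumber TrivSqZeroExt

namespace Summit.Ventures.HSemireg

namespace EmbeddedDeformation

universe u v

section Kernel

variable {R' : Type u} {R : Type v} [CommRing R'] [CommRing R] {π : R' →+* R} {e : R'}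

/-- The kernel of a flat first-order thickening is `(e)`. -/
theorem IsFirstOrderThickening.mem_ker_iff (hT : IsFirstOrderThickening π e) (z : R') :
    z ∈ RingHom.ker π ↔ ∃ w : R', z = e * w := by
  rw [RingHom.mem_ker]
  exact hT.ker_iff z

/-- **`(ker π)² = 0`**: the kernel of a flat first-order thickening has square zero (`e² = 0`). -/
theorem IsFirstOrderThickening.ker_pow_two_eq_bot (hT : IsFirstOrderThickening π e) : RingHom.ker π ^ 2 = ⊥ := by
  rw [pow_two, eq_bot_iff]
  refine Ideal.mul_le.2 fun z hz z' hz' => ?_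
  obtain ⟨w, rfl⟩ := (hT.mem_ker_iff z).1 hz
  obtain ⟨w', rfl⟩ := (hT.mem_ker_iff z').1 hz'
  rw [Ideal.mem_bot]
  have h2 := hT.eps_sq
  linear_combination (w * w') * h2

/-- Hence the kernel is a nilpotent ideal. -/
theorem IsFirstOrderThickening.isNilpotent_ker (hT : IsFirstOrderThickening π e) : IsNilpotent (RingHom.ker π) :=
  ⟨2, hT.ker_pow_two_eq_bot⟩

end Kernel

/-! ## The section from formal smoothness -/

section Smooth

variable {k : Type*} [CommRing k] {R' R : Type u} [CommRing R'] [CommRing R] [Algebra k R'] [Algebra k R]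

/-- **A flat first-order thickening of a formally smooth affine splits.**  If `R` is formally smooth over `k` and
`π : R' → R` is a `k`-algebra map which is a flat first-order thickening, then `π` has a `k`-algebra section
(the infinitesimal lifting property against the square-zero kernel `(e)`). [Hartshorne2010 §4 Prop. 4.4 / Cor. 4.8, the
case `A = k[ε]`; EGA IV 17.1.1] -/
theorem IsFirstOrderThickening.exists_algHom_section [Algebra.FormallySmooth k R] (π : R' →ₐ[k] R) {e : R'}
    (hT : IsFirstOrderThickening π.toRingHom e) : ∃ σ : R →ₐ[k] R', ∀ a, π (σ a) = a := by
  have hnil : IsNilpotent (RingHom.ker (π : R' →+* R)) := hT.isNilpotent_ker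
  exact ⟨Algebra.FormallySmooth.liftOfSurjective (AlgHom.id k R) π hT.surjective hnil,
    fun a => Algebra.FormallySmooth.liftOfSurjective_apply (AlgHom.id k R) π hT.surjective hnil a⟩

/-- Ring-hom form of the section. -/
theorem IsFirstOrderThickening.exists_section [Algebra.FormallySmooth k R] (π : R' →ₐ[k] R) {e : R'}
    (hT : IsFirstOrderThickening π.toRingHom e) : ∃ σ : R →+* R', ∀ a, π.toRingHom (σ a) = a := by
  obtain ⟨σ, hσ⟩ := hT.exists_algHom_section π
  exact ⟨σ.toRingHom, hσ⟩

end Smooth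

/-! ## The trivialisation `R[ε] ≃ R'` attached to a section -/

section Trivialization

variable {R' R : Type u} [CommRing R'] [CommRing R] {π : R' →+* R} {e : R'}

/-- The ring map `R[ε] → R'`, `a + ε b ↦ σ a + e σ b`, attached to a section `σ` of `π` (`e² = 0` makes it
multiplicative). -/
def trivializationHom (hT : IsFirstOrderThickening π e) (σ : R →+* R') : R[ε] →+* R' where
  toFun z := σ z.fst + e * σ z.snd
  map_one' := by simp
  map_mul' z w := by
    have h2 := hT.eps_sq
    rw [TrivSqZeroExt.fst_mul, DualNumber.snd_mul, map_mul, map_add, map_mul, map_mul]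
    linear_combination (-(σ z.snd * σ w.snd)) * h2
  map_zero' := by simp
  map_add' z w := by
    simp only [TrivSqZeroExt.fst_add, TrivSqZeroExt.snd_add, map_add]
    ring

/-- The value of the trivialisation map. -/
theorem trivializationHom_apply (hT : IsFirstOrderThickening π e) (σ : R →+* R') (z : R[ε]) :
    trivializationHom hT σ z = σ z.fst + e * σ z.snd := rfl

/-- It is compatible with the two augmentations: `π (σ a + e σ b) = a`. -/
theorem map_trivializationHom (hT : IsFirstOrderThickening π e) (σ : R →+* R') (hσ : ∀ a, π (σ a) = a) (z : R[ε]) :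
    π (trivializationHom hT σ z) = z.fst := by
  rw [trivializationHom_apply, map_add, map_mul, hT.map_eps, zero_mul, add_zero, hσ]

/-- It is a bijection: onto by `r = σ(π r) + e σ b` (file `…Cocycle`), into because `σ a + e σ b = 0` forces `a = π 0 = 0`
and then `σ b ∈ Ann(e) ⊆ (e)`, so `b = π (σ b) = 0`. -/
theorem trivializationHom_bijective (hT : IsFirstOrderThickening π e) (σ : R →+* R') (hσ : ∀ a, π (σ a) = a) :
    Function.Bijective (trivializationHom hT σ) := by
  constructor
  · rw [injective_iff_map_eq_zero]
    intro z hz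
    have ha : z.fst = 0 := by rw [← map_trivializationHom hT σ hσ z, hz, map_zero]
    rw [trivializationHom_apply, ha, map_zero, zero_add] at hz
    obtain ⟨w, hw⟩ := hT.ann_le (σ z.snd) hz
    have hb : z.snd = 0 := by rw [← hσ z.snd, hw, map_mul, hT.map_eps, zero_mul]
    exact TrivSqZeroExt.ext ha hb
  · intro r
    obtain ⟨b, hb⟩ := hT.exists_eq_section_add σ hσ r
    exact ⟨inl (π r) + ε * inl b, by rw [trivializationHom_apply, fst_inl_add_eps_mul_inl, snd_inl_add_eps_mul_inl, ← hb]⟩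

/-- **The trivialisation `R[ε] ≃+* R'`** attached to a section `σ` of a flat first-order thickening
(«`X_ε|_U ≅ U[ε]`» for `U = Spec R`, non-canonical: it depends on `σ`). -/
noncomputable def IsFirstOrderThickening.trivialization (hT : IsFirstOrderThickening π e) (σ : R →+* R')
    (hσ : ∀ a, π (σ a) = a) : R[ε] ≃+* R' :=
  RingEquiv.ofBijective (trivializationHom hT σ) (trivializationHom_bijective hT σ hσ)

/-- The trivialisation restricted to `R ⊂ R[ε]` is `σ`. -/
@[simp] theorem IsFirstOrderThickening.trivialization_inl (hT : IsFirstOrderThickening π e) (σ : R →+* R')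
    (hσ : ∀ a, π (σ a) = a) (a : R) : hT.trivialization σ hσ (inl a) = σ a := by
  change trivializationHom hT σ (inl a) = σ a
  rw [trivializationHom_apply, fst_inl, snd_inl, map_zero, mul_zero, add_zero]

/-- The trivialisation sends `ε` to the parameter `e`. -/
@[simp] theorem IsFirstOrderThickening.trivialization_eps (hT : IsFirstOrderThickening π e) (σ : R →+* R')
    (hσ : ∀ a, π (σ a) = a) : hT.trivialization σ hσ ε = e := by
  change trivializationHom hT σ ε = e
  rw [trivializationHom_apply, fst_eps, snd_eps, map_zero, map_one, zero_add, mul_one]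

/-- **Compatibility with the augmentations**: `π ∘ trivialization = fst`. -/
theorem IsFirstOrderThickening.map_trivialization (hT : IsFirstOrderThickening π e) (σ : R →+* R')
    (hσ : ∀ a, π (σ a) = a) (z : R[ε]) : π (hT.trivialization σ hσ z) = z.fst :=
  map_trivializationHom hT σ hσ z

/-! ### Two sections differ by a twist (Prop. K's transition functions `ψ_αβ = id + ε θ_αβ`) -/

/-- The change of trivialisation between two sections lies over the identity of `R` … -/
theorem IsFirstOrderThickening.fst_transition (hT : IsFirstOrderThickening π e) (σ σ' : R →+* R')
    (hσ : ∀ a, π (σ a) = a) (hσ' : ∀ a, π (σ' a) = a) (z : R[ε]) :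
    (((hT.trivialization σ' hσ').trans (hT.trivialization σ hσ).symm) z).fst = z.fst := by
  have h := hT.map_trivialization σ hσ ((hT.trivialization σ hσ).symm (hT.trivialization σ' hσ' z))
  rw [RingEquiv.apply_symm_apply, hT.map_trivialization σ' hσ'] at h
  exact h.symm

/-- … and fixes `ε`. -/
theorem IsFirstOrderThickening.transition_eps (hT : IsFirstOrderThickening π e) (σ σ' : R →+* R')
    (hσ : ∀ a, π (σ a) = a) (hσ' : ∀ a, π (σ' a) = a) :
    ((hT.trivialization σ' hσ').trans (hT.trivialization σ hσ).symm) ε = ε := by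
  rw [RingEquiv.trans_apply, hT.trivialization_eps σ' hσ', RingEquiv.symm_apply_eq, hT.trivialization_eps σ hσ]

/-- **The transition derivation** `θ(σ, σ')` of two sections: the derivation of the automorphism `τ_σ⁻¹ ∘ τ_{σ'}` of
`R[ε]` (file `…Cocycle`, `derivationOfAut`; Hartshorne Ex. 5.2). -/
noncomputable def IsFirstOrderThickening.transitionDerivation (hT : IsFirstOrderThickening π e) (σ σ' : R →+* R')
    (hσ : ∀ a, π (σ a) = a) (hσ' : ∀ a, π (σ' a) = a) : Derivation ℤ R R :=
  derivationOfAut ((hT.trivialization σ' hσ').trans (hT.trivialization σ hσ).symm) (hT.fst_transition σ σ' hσ hσ')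

/-- **Two trivialisations differ by the twist of their transition derivation**: `τ_σ⁻¹ ∘ τ_{σ'} = twist θ(σ, σ')` —
Prop. K's «the transition automorphisms are `ψ_αβ = id + ε θ_αβ`», for the two smooth sections of one thickening over
an overlap.  (With file `…Cocycle`'s `map_twist_liftIdeal`, `ψ_αβ` carries `J_φ` to `J_{φ + θ̄_αβ|_I}`.) -/
theorem IsFirstOrderThickening.twist_transitionDerivation (hT : IsFirstOrderThickening π e) (σ σ' : R →+* R')
    (hσ : ∀ a, π (σ a) = a) (hσ' : ∀ a, π (σ' a) = a) :
    twist (hT.transitionDerivation σ σ' hσ hσ') = (hT.trivialization σ' hσ').trans (hT.trivialization σ hσ).symm :=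
  twist_derivationOfAut _ (hT.fst_transition σ σ' hσ hσ') (hT.transition_eps σ σ' hσ hσ')

/-- The transition derivation measures the difference of the sections: `e · σ(θ a) = σ' a − σ a`. -/
theorem IsFirstOrderThickening.eps_mul_section_transitionDerivation (hT : IsFirstOrderThickening π e)
    (σ σ' : R →+* R') (hσ : ∀ a, π (σ a) = a) (hσ' : ∀ a, π (σ' a) = a) (a : R) :
    e * σ (hT.transitionDerivation σ σ' hσ hσ' a) = σ' a - σ a := by
  have h := congrArg (hT.trivialization σ hσ) (RingEquiv.congr_fun (hT.twist_transitionDerivation σ σ' hσ hσ') (inl a))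
  rw [RingEquiv.trans_apply, RingEquiv.apply_symm_apply, hT.trivialization_inl σ' hσ', twist_inl, map_add, map_mul,
    hT.trivialization_inl σ hσ, hT.trivialization_eps σ hσ, hT.trivialization_inl σ hσ] at h
  linear_combination h

/-- Two sections agree after multiplication by `e` (`σ' y − σ y ∈ ker π = (e)` and `e² = 0`). -/
theorem IsFirstOrderThickening.eps_mul_section_eq (hT : IsFirstOrderThickening π e) (σ σ' : R →+* R')
    (hσ : ∀ a, π (σ a) = a) (hσ' : ∀ a, π (σ' a) = a) (y : R) : e * σ' y = e * σ y := by
  obtain ⟨w, hw⟩ := (hT.ker_iff (σ' y - σ y)).1 (by rw [map_sub, hσ, hσ', sub_self])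
  have h2 := hT.eps_sq
  have : e * (σ' y - σ y) = 0 := by rw [hw, ← mul_assoc, h2, zero_mul]
  rwa [mul_sub, sub_eq_zero] at this

/-- `e · σ x = 0 ⟹ x = 0` (`σ x ∈ Ann(e) ⊆ (e) = ker π`, then apply `π`). -/
theorem IsFirstOrderThickening.eq_zero_of_eps_mul_section (hT : IsFirstOrderThickening π e) (σ : R →+* R')
    (hσ : ∀ a, π (σ a) = a) {x : R} (h : e * σ x = 0) : x = 0 := by
  obtain ⟨w, hw⟩ := hT.ann_le (σ x) h
  rw [← hσ x, hw, map_mul, hT.map_eps, zero_mul]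

/-- `θ(σ, σ) = 0`. -/
theorem IsFirstOrderThickening.transitionDerivation_self (hT : IsFirstOrderThickening π e) (σ : R →+* R')
    (hσ : ∀ a, π (σ a) = a) : hT.transitionDerivation σ σ hσ hσ = 0 := by
  ext a
  refine hT.eq_zero_of_eps_mul_section σ hσ ?_
  rw [hT.eps_mul_section_transitionDerivation, sub_self]

/-- **The transition derivations form a ČECH 1-COCYCLE**: `θ(σ, σ″) = θ(σ, σ′) + θ(σ′, σ″)` for any three sections
(Prop. K: «(θ_αβ) is a Čech cocycle for θ»; on a triple overlap the three local trivialisations give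
`θ_αγ = θ_αβ + θ_βγ`). -/
theorem IsFirstOrderThickening.transitionDerivation_cocycle (hT : IsFirstOrderThickening π e)
    (σ σ' σ'' : R →+* R') (hσ : ∀ a, π (σ a) = a) (hσ' : ∀ a, π (σ' a) = a) (hσ'' : ∀ a, π (σ'' a) = a) :
    hT.transitionDerivation σ σ'' hσ hσ'' =
      hT.transitionDerivation σ σ' hσ hσ' + hT.transitionDerivation σ' σ'' hσ' hσ'' := by
  ext a
  rw [Derivation.add_apply, ← sub_eq_zero]
  refine hT.eq_zero_of_eps_mul_section σ hσ ?_
  rw [map_sub, map_add, mul_sub, mul_add, hT.eps_mul_section_transitionDerivation σ σ'' hσ hσ'',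
    hT.eps_mul_section_transitionDerivation σ σ' hσ hσ', ← hT.eps_mul_section_eq σ σ' hσ hσ',
    hT.eps_mul_section_transitionDerivation σ' σ'' hσ' hσ'']
  ring

/-- Antisymmetry: `θ(σ′, σ) = −θ(σ, σ′)`. -/
theorem IsFirstOrderThickening.transitionDerivation_swap (hT : IsFirstOrderThickening π e) (σ σ' : R →+* R')
    (hσ : ∀ a, π (σ a) = a) (hσ' : ∀ a, π (σ' a) = a) :
    hT.transitionDerivation σ' σ hσ' hσ = -hT.transitionDerivation σ σ' hσ hσ' := by
  rw [eq_neg_iff_add_eq_zero, add_comm, ← hT.transitionDerivation_cocycle σ σ' σ hσ hσ' hσ,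
    hT.transitionDerivation_self]

/-- **Prop. K's «`ψ_αβ` carries `J_{φ_β}` to `J_{φ_β + θ̄_αβ|_I}`», inside the thickening `R'` itself:** the difference
class (file `…Torsor`, `IsLift.diff`) of the two trivial lifts `σ(I)R'` and `σ'(I)R'` of an ideal `I` is the normal vector
`θ̄(σ,σ')|_I` of their transition derivation (file `…Cocycle`, `derivToNormal`). -/
theorem IsFirstOrderThickening.diff_map_section (hT : IsFirstOrderThickening π e) (σ σ' : R →+* R')
    (hσ : ∀ a, π (σ a) = a) (hσ' : ∀ a, π (σ' a) = a) (I : Ideal R) :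
    (isLift_map_section hT σ hσ I).diff hT (isLift_map_section hT σ' hσ' I) =
      derivToNormal I (hT.transitionDerivation σ σ' hσ hσ') := by
  apply LinearMap.ext
  intro x
  rw [derivToNormal_apply, (isLift_map_section hT σ hσ I).diff_apply_eq hT (isLift_map_section hT σ' hσ' I)
    (Ideal.mem_map_of_mem σ x.2) (Ideal.mem_map_of_mem σ' x.2) (hσ x) (hσ' x)
    (w := σ (hT.transitionDerivation σ σ' hσ hσ' x)) (by rw [hT.eps_mul_section_transitionDerivation]), hσ]

end Trivialization

/-! ## Consequences over a formally smooth affine -/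

section Consequences

variable {k : Type*} [CommRing k] {R' R : Type u} [CommRing R'] [CommRing R] [Algebra k R'] [Algebra k R]

/-- **Every flat first-order thickening of a formally smooth affine is the dual-number one** (up to a non-canonical
isomorphism over the augmentation): «`X_ε|_U ≅ U[ε]`», the opening line of the proof of Proposition K. -/
theorem IsFirstOrderThickening.nonempty_trivialization [Algebra.FormallySmooth k R] (π : R' →ₐ[k] R) {e : R'}
    (hT : IsFirstOrderThickening π.toRingHom e) :
    ∃ τ : R[ε] ≃+* R', τ ε = e ∧ ∀ z, π (τ z) = z.fst := by
  obtain ⟨σ, hσ⟩ := hT.exists_section π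
  exact ⟨hT.trivialization σ hσ, hT.trivialization_eps σ hσ, hT.map_trivialization σ hσ⟩

/-- **Hartshorne Thm. 6.2 (a), affine nonsingular case: over a formally smooth affine the flat lifts of every ideal
`I` to every flat first-order thickening are in bijection with `Hom_R(I, R/I)`** (the pseudotorsor of file `…Torsor` is
a torsor, trivialised by the smooth section: `splitTorsorEquiv`). -/
theorem IsFirstOrderThickening.nonempty_liftEquiv [Algebra.FormallySmooth k R] (π : R' →ₐ[k] R) {e : R'}
    (hT : IsFirstOrderThickening π.toRingHom e) (I : Ideal R) :
    Nonempty ({J : Ideal R' // IsLift π.toRingHom e I J} ≃ (I →ₗ[R] R ⧸ I)) := by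
  obtain ⟨σ, hσ⟩ := hT.exists_section π
  exact ⟨splitTorsorEquiv hT σ hσ I⟩

/-- In particular a flat lift EXISTS (the one through the section: `σ(I)·R'`). -/
theorem IsFirstOrderThickening.exists_isLift [Algebra.FormallySmooth k R] (π : R' →ₐ[k] R) {e : R'}
    (hT : IsFirstOrderThickening π.toRingHom e) (I : Ideal R) : ∃ J : Ideal R', IsLift π.toRingHom e I J := by
  obtain ⟨σ, hσ⟩ := hT.exists_section π
  exact ⟨I.map σ, isLift_map_section hT σ hσ I⟩

/-- **The instance of record**: every flat first-order `K`-thickening of the affine space `𝔸ⁿ_K = Spec K[x_1, …, x_n]`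
(the ambient ring of the block models of (S5)) splits, `K` any commutative ring (Mathlib:
`MvPolynomial` is formally smooth; so are its localisations, `Algebra.FormallySmooth.of_isLocalization`). -/
theorem exists_section_mvPolynomial {K : Type u} [CommRing K] {n : ℕ} {R' : Type u} [CommRing R'] [Algebra K R']
    (π : R' →ₐ[K] MvPolynomial (Fin n) K) {e : R'} (hT : IsFirstOrderThickening π.toRingHom e) :
    ∃ σ : MvPolynomial (Fin n) K →ₐ[K] R', ∀ a, π (σ a) = a :=
  hT.exists_algHom_section π

/-- … and of every basic open `D(f) ⊂ 𝔸ⁿ_K`, indeed of `Spec` of any localisation of `K[x_1, …, x_n]` (Mathlib: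
localisations of formally smooth algebras are formally smooth) — the chart rings of the Zariski covers in Prop. K. -/
theorem exists_section_localization_mvPolynomial {K : Type u} [CommRing K] {n : ℕ}
    (M : Submonoid (MvPolynomial (Fin n) K)) {R' : Type u} [CommRing R'] [Algebra K R']
    (π : R' →ₐ[K] Localization M) {e : R'} (hT : IsFirstOrderThickening π.toRingHom e) :
    ∃ σ : Localization M →ₐ[K] R', ∀ a, π (σ a) = a :=
  hT.exists_algHom_section π

end Consequences

end EmbeddedDeformation

end Summit.Ventures.HSemireg
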